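import Summits.SmoothPoincare4.SmoothPoincare4.Theorems.EntropyRungConicalGapRicciNormSqIntegrable
import Summits.SmoothPoincare4.SmoothPoincare4.Theorems.EntropyRungConicalGapGradScalarIdentity
import Literature.Geometry.Lorentzian.VolumePositivity
import HarnessLib

/-!
# Helper `helper_ricciPinchingGap` of line `Sketch` — the Ricci pinching gap `sup 2|Ric|²/R ≥ 1`
# (crux `EntropyRung.ConicalGap`, stmt-SmoothPoincare4-16589; lead seat c4, cycle 4)

A first GEOMETRIC consequence of the cycle's unconditional Ricci side: on every complete connected
normalised NON-FLAT 4-d gradient shrinking Ricci soliton `(M, g, f)` (`Ric + Hess f = g/2`,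
`R + |∇f|² = f`, `R ≢ 0`) and for every `c < 1` there is a point with

  `c · R(x) < 2 |Ric|²(x)`,

i.e. `sup_M 2|Ric|²/R ≥ 1` — sharp: equality `2|Ric|² ≡ R` holds on every Einstein shrinker
(`S⁴(√6)`), on the cylinders `S³(2)×ℝ`, `S²×ℝ²` and on all their quotients (exactly the shrinkers
with `∇R ≡ 0`). Proof: if `2|Ric|² ≤ c R` everywhere then, `R ≥ 0` being a theorem of the tree,
`2R|Ric|² ≤ c R²`, and the weighted Bochner identity at `τ = 1`
(`gradScalar_weightedIdentity_riemVolume`, p134908, its proviso supplied by `ricciNormSq_integrable`,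
p134963) gives `0 ≤ ∫ |∇R|² e^{-f} = 2∫ R|Ric|² e^{-f} − ∫ R² e^{-f} ≤ (c − 1) ∫ R² e^{-f}`, so
`∫ R² e^{-f} dV = 0`; continuity and positivity of `dV` on open sets
(`isOpenPosMeasure_riemannianMeasure`) force `R ≡ 0`. Everything here is proved; no definition and no
named fact is introduced.

## References

* P. Petersen, W. Wylie, *On the classification of gradient Ricci solitons*, Geom. Topol. 14 (2010)
  2277–2300, §2 (the weighted identities for `R` behind such gaps). [PetersenWylie2010]
* O. Munteanu, N. Sesum, J. Geom. Anal. 23 (2013) 539–561, Thm. 1.4 / 1.5. [MunteanuSesum2013]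
-/

noncomputable section

-- `Summit.SmoothPoincare4.SmoothPoincare4.…` (summit = problem) trips `dupNamespace` on every decl.
set_option linter.dupNamespace false

open scoped Manifold ContDiff ENNReal NNReal Topology
open MeasureTheory Set Filter
open Literature.Geometry.Lorentzian Literature.Geometry.Riemannian

namespace Summit.SmoothPoincare4.SmoothPoincare4.Theorems.ConicalGapSketch

section RiemVolume

variable {M : Type} [TopologicalSpace M] [T2Space M] [SecondCountableTopology M]
  [ChartedSpace (EuclideanSpace ℝ (Fin 4)) M] [IsManifold (𝓡 4) ∞ M] [ConnectedSpace M]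
  [T3Space M] [MeasurableSpace M] [BorelSpace M]

/-- **The Ricci pinching gap** (over `g.riemVolume`): on a complete connected normalised 4-d gradient
shrinker with `2 |Ric|² ≤ c R` everywhere for some `c < 1`, the scalar curvature vanishes identically
(weighted Bochner identity at `τ = 1` + positivity of the Riemannian measure on open sets). -/
theorem scalarCurvature_eq_zero_of_ricciPinching
    (g : PseudoRiemannianMetric (𝓡 4) ∞ (EuclideanSpace ℝ (Fin 4)) (TangentSpace (𝓡 4) : M → Type _))
    [g.HasLeviCivita] (f : M → ℝ) (hg : g.IsRiemannian)
    (hc : ∀ (x : M) (r : NNReal), IsCompact {y : M | g.edist hg x y ≤ r})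
    (hf : ContMDiff (𝓡 4) 𝓘(ℝ, ℝ) ∞ f)
    (hsol : ∀ (x : M) (X Y : TangentSpace (𝓡 4) x),
      g.ricci x X Y + g.hessian f x X Y = (1 / 2 : ℝ) * g.val x X Y)
    (hnorm : ∀ x : M, g.scalarCurvature x + g.gradSq f x = f x) {c : ℝ} (hc1 : c < 1)
    (hpinch : ∀ x : M, 2 * g.normSq x (g.ricci x) ≤ c * g.scalarCurvature x) :
    ∀ x : M, g.scalarCurvature x = 0 := by
  obtain ⟨hR0, -, hprop⟩ :=
    NoncompactShrinkerGapCarrilloNiClauses.scalarCurvature_nonneg_and_isCompact_sublevel g f hg hc hf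
      hsol hnorm
  have hRic : ∀ σ : ℝ, 0 < σ →
      Integrable (fun x ↦ g.normSq x (g.ricci x) * Real.exp (-f x / σ)) g.riemVolume :=
    fun σ hσ ↦ ricciNormSq_integrable hg hf hsol hnorm hprop hR0 hσ
  obtain ⟨iG, hB⟩ := gradScalar_weightedIdentity_riemVolume hg hf hsol hnorm hprop hR0 hRic one_pos
  simp only [div_one, inv_one, sub_self, zero_mul, sub_zero] at iG hB
  -- the weights at `τ = 1`
  have iR2 : Integrable (fun x ↦ g.scalarCurvature x ^ 2 * Real.exp (-f x)) g.riemVolume := by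
    simpa only [div_one] using ricciMoment_integrable_sq hg hf hsol hnorm hprop hR0 one_pos
  have iRN : Integrable (fun x ↦ g.scalarCurvature x * g.normSq x (g.ricci x) * Real.exp (-f x))
      g.riemVolume := by
    have h := weightedMoments_integrable_pow_mul_scalarCurvature_mul_normSq hg hf hnorm hR0 hRic 0
      one_pos
    simpa only [pow_zero, one_mul, div_one] using h
  -- `0 ≤ ∫ |∇R|² e^{-f}` and `2 ∫ R|Ric|² e^{-f} ≤ c ∫ R² e^{-f}`
  have hG0 : 0 ≤ ∫ x, g.gradSq g.scalarCurvature x * Real.exp (-f x) ∂g.riemVolume :=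
    integral_nonneg fun x ↦ mul_nonneg (g.gradSq_nonneg hg _ x) (Real.exp_pos _).le
  have hRN : 2 * ∫ x, g.scalarCurvature x * g.normSq x (g.ricci x) * Real.exp (-f x) ∂g.riemVolume ≤
      c * ∫ x, g.scalarCurvature x ^ 2 * Real.exp (-f x) ∂g.riemVolume := by
    rw [← integral_const_mul, ← integral_const_mul]
    refine integral_mono (iRN.const_mul 2) (iR2.const_mul c) fun x ↦ ?_
    have h1 : g.scalarCurvature x * (2 * g.normSq x (g.ricci x)) ≤
        g.scalarCurvature x * (c * g.scalarCurvature x) :=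
      mul_le_mul_of_nonneg_left (hpinch x) (hR0 x)
    have h2 := Real.exp_pos (-f x)
    nlinarith
  -- hence `∫ R² e^{-f} = 0`
  have hR2pos : 0 ≤ ∫ x, g.scalarCurvature x ^ 2 * Real.exp (-f x) ∂g.riemVolume :=
    integral_nonneg fun x ↦ mul_nonneg (sq_nonneg _) (Real.exp_pos _).le
  have hzero : ∫ x, g.scalarCurvature x ^ 2 * Real.exp (-f x) ∂g.riemVolume = 0 := by
    nlinarith
  -- so `R² e^{-f} = 0` a.e., hence everywhere by continuity and positivity on open sets
  have hae : (fun x ↦ g.scalarCurvature x ^ 2 * Real.exp (-f x)) =ᵐ[g.riemVolume] 0 :=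
    (integral_eq_zero_iff_of_nonneg (fun x ↦ mul_nonneg (sq_nonneg _) (Real.exp_pos _).le)
      iR2).1 hzero
  have hcont : Continuous fun x ↦ g.scalarCurvature x ^ 2 * Real.exp (-f x) :=
    ((PseudoRiemannianMetric.contMDiff_scalarCurvature g).continuous.pow 2).mul
      (Real.continuous_exp.comp hf.continuous.neg)
  haveI : g.riemVolume.IsOpenPosMeasure := by
    rw [PseudoRiemannianMetric.riemVolume_eq hg]
    exact isOpenPosMeasure_riemannianMeasure (g.toContMDiffRiemannianMetric hg)
  have hfun : (fun x ↦ g.scalarCurvature x ^ 2 * Real.exp (-f x)) = 0 :=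
    (hcont.ae_eq_iff_eq g.riemVolume continuous_const).1 hae
  intro x
  have hx := congrFun hfun x
  simp only [Pi.zero_apply, mul_eq_zero, (Real.exp_pos _).ne', or_false] at hx
  exact pow_eq_zero_iff two_ne_zero |>.1 hx

end RiemVolume

/-! ## The registered helper (crux vocabulary) -/

/-- **Helper `helper_ricciPinchingGap` of line `Sketch`** (the Ricci pinching gap `sup 2|Ric|²/R ≥ 1`,
`n = 4`, UNCONDITIONAL): on every complete connected normalised NON-FLAT 4-d gradient shrinking Ricci
soliton and for every `c < 1` there is a point `x` with `c · R(x) < 2 |Ric|²(x)` — sharp on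
`S⁴(√6)`, `S³(2)×ℝ`, `S²×ℝ²` and quotients (`2|Ric|² ≡ R`): `scalarCurvature_eq_zero_of_ricciPinching`
by contraposition. -/
theorem helper_ricciPinchingGap : ∀ (M : Type) [TopologicalSpace M] [T2Space M] [SecondCountableTopology M] [ChartedSpace (EuclideanSpace ℝ (Fin 4)) M] [IsManifold (𝓡 4) ∞ M] [ConnectedSpace M] [T3Space M] [MeasurableSpace M] [BorelSpace M] (g : Literature.Geometry.Lorentzian.PseudoRiemannianMetric (𝓡 4) ∞ (EuclideanSpace ℝ (Fin 4)) (TangentSpace (𝓡 4) : M → Type _)) [g.HasLeviCivita] (f : M → ℝ) (hg : g.IsRiemannian), (∀ (x : M) (r : NNReal), IsCompact {y : M | g.edist hg x y ≤ r}) → ContMDiff (𝓡 4) 𝓘(ℝ, ℝ) ∞ f → (∀ (x : M) (X Y : TangentSpace (𝓡 4) x), g.ricci x X Y + g.hessian f x X Y = (1 / 2 : ℝ) * g.val x X Y) → (∀ x : M, g.scalarCurvature x + g.gradSq f x = f x) → (∃ x : M, g.scalarCurvature x ≠ 0) → ∀ c : ℝ, c < 1 → ∃ x : M, c * g.scalarCurvature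 x < 2 * g.normSq x (g.ricci x) := by
  intro M _ _ _ _ _ _ _ _ _ g _ f hg hc hf hsol hnorm hnf c hc1
  by_contra h
  push Not at h
  obtain ⟨x₀, hx₀⟩ := hnf
  exact hx₀ (scalarCurvature_eq_zero_of_ricciPinching g f hg hc hf hsol hnorm hc1 h x₀)

end Summit.SmoothPoincare4.SmoothPoincare4.Theorems.ConicalGapSketch

end
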